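import Literature.AlgebraicGeometry.RelativeSpec.SymmetricPowerGlued
import Literature.AlgebraicGeometry.RelativeSpec.FiniteGroupQuotientFinsetAffine
import HarnessLib

/-!
# A commuting action descends to the glued quotient `X/Γ`, with its stable affine cover
# (SGA 1 V §1; Mumford AV §7 Thm. p. 66, Remark — proofs + one construction)

Topic `Literature/AlgebraicGeometry/RelativeSpec`; namespace `Literature.AlgebraicGeometry.RelativeSpec.ActionOver`. Cell
`hodgecm-mathlib`, P6 «MOD programme», LEAD F0P6-plan ruling M-2c, letter GALQ (`RecordGaloisQuotientDescent`): «the `G`-action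
DESCENDS along the quotient map … (the `(1, g)` commute with `Γ × 1`) with every point in a `ρ`-stable affine open (images of the
`θ`-stable ones)» — the one small organ the LEAD named («the descent of a commuting action along `gluedMk` with its stable affine cover»).

Setting: `r : X ⟶ Y` separated with `Y` separated, `ρ : ActionOver r Γ` an action of a finite group `Γ` with Mumford's hypothesis
`hcov` (every point in a `Γ`-stable open affine over `Y`), so that the quotient `π = ρ.gluedMk hcov : X ⟶ ρ.glued = X/Γ` over `Y`
(`ρ.gluedDesc r ρ.aut_comp : X/Γ ⟶ Y`) exists (★ `FiniteGroupQuotientGluing`); and a second action `σ : ActionOver r G` of a group `G`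
COMMUTING with `ρ`.

* `descHom`, `gluedMk_descHom` — an `r`-automorphism `α` of `X` commuting with `Γ` descends uniquely to `ᾱ : X/Γ ⟶ X/Γ` with
  `π ≫ ᾱ = α ≫ π` (universal property of the categorical quotient, ★ `gluedDesc` ∕ `glued_hom_ext`);
* **`descAction σ … : ActionOver (ρ.gluedDesc r ρ.aut_comp) G`** — the descended action of `G` on `X/Γ` over `Y`, with
  `gluedMk_descAction_aut : (σ.aut g).hom ≫ π = π ≫ ((descAction …).aut g).hom` and uniqueness `descAction_aut_unique`;
* **`exists_stableAffineOpen_descAction`** — for `Y` AFFINE: if every point of `X` lies in a `Γ`-stable open affine over `Y` which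
  is also `σ`-stable, then every point of `X/Γ` lies in a `descAction`-stable open affine over `Y` (the image chart `O/Γ ↪ X/Γ`, affine:
  ★ `isAffine_pieceQuot`);
* `prodAction_*` — the case of ONE action `θ` of `Γ × G` (`ρ = θ ∘ inl`, `σ = θ ∘ inr` commute), as in GALQ.

## References
* [SGA1] A. Grothendieck, SGA 1, Exp. V §1, Prop. 1.1, Prop. 1.8 (quotient by a finite group; stable affine opens).
* [MumfordAV1970] D. Mumford, *Abelian Varieties* (1970), §7 Thm. p. 66 and Remark (universal property of `X/G`).
-/

noncomputable section

universe u

open CategoryTheory AlgebraicGeometry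

namespace Literature.AlgebraicGeometry.RelativeSpec.ActionOver

variable {X Y : Scheme.{u}} {r : X ⟶ Y} {Γ : Type*} [Group Γ] [Finite Γ] [Y.IsSeparated] [IsSeparated r]
  (ρ : ActionOver r Γ) (hcov : ∀ x : X, ∃ O : ρ.StableAffineOpens, x ∈ O.1)

/-! ## §1 The quotient `X/Γ` is a separated scheme -/

include hcov in
/-- `X/Γ` is separated (as a scheme): `X/Γ → Y` is separated (★ `isSeparated_gluedDesc`) and `Y` is. [cite: MumfordAV1970, §7 Thm. p. 66] -/
theorem isSeparated_glued : ρ.glued.IsSeparated := by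
  haveI := ρ.isSeparated_gluedDesc hcov r ρ.aut_comp
  exact ⟨by rw [← Limits.terminal.comp_from (ρ.gluedDesc r ρ.aut_comp)]; infer_instance⟩

/-! ## §2 Descent of a commuting automorphism -/

section DescHom

variable (α : X ⟶ X) (hα : ∀ γ : Γ, (ρ.aut γ).hom ≫ α = α ≫ (ρ.aut γ).hom)

/-- The descent `ᾱ : X/Γ ⟶ X/Γ` of an endomorphism `α` of `X` commuting with `Γ` (`π ≫ ᾱ = α ≫ π`).
[cite: MumfordAV1970, §7 Thm. p. 66 (Remark)] -/
def descHom : ρ.glued ⟶ ρ.glued :=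
  haveI := ρ.isSeparated_glued hcov
  ρ.gluedDesc (α ≫ ρ.gluedMk hcov) fun γ => by rw [← Category.assoc, hα γ, Category.assoc, ρ.aut_hom_gluedMk hcov γ]

/-- `π ≫ ᾱ = α ≫ π`. [cite: MumfordAV1970, §7 Thm. p. 66 (Remark)] -/
@[reassoc]
theorem gluedMk_descHom : ρ.gluedMk hcov ≫ ρ.descHom hcov α hα = α ≫ ρ.gluedMk hcov := by
  haveI := ρ.isSeparated_glued hcov
  exact ρ.gluedMk_gluedDesc hcov _ _

/-- Uniqueness of the descent: any `β` with `π ≫ β = α ≫ π` is `ᾱ`. [cite: MumfordAV1970, §7 Thm. p. 66 (Remark)] -/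
theorem descHom_unique {β : ρ.glued ⟶ ρ.glued} (hβ : ρ.gluedMk hcov ≫ β = α ≫ ρ.gluedMk hcov) :
    β = ρ.descHom hcov α hα := by
  haveI := ρ.isSeparated_glued hcov
  exact ρ.glued_hom_ext hcov (hβ.trans (ρ.gluedMk_descHom hcov α hα).symm)

end DescHom

/-- The descent of the identity is the identity. [cite: MumfordAV1970, §7 Thm. p. 66 (Remark)] -/
theorem descHom_id : ρ.descHom hcov (𝟙 X) (fun γ => by rw [Category.comp_id, Category.id_comp]) = 𝟙 _ :=
  (ρ.descHom_unique hcov (𝟙 X) _ (by rw [Category.comp_id, Category.id_comp])).symm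

/-- The descent of a composite is the composite of the descents. [cite: MumfordAV1970, §7 Thm. p. 66 (Remark)] -/
theorem descHom_comp (α β : X ⟶ X) (hα : ∀ γ : Γ, (ρ.aut γ).hom ≫ α = α ≫ (ρ.aut γ).hom)
    (hβ : ∀ γ : Γ, (ρ.aut γ).hom ≫ β = β ≫ (ρ.aut γ).hom) :
    ρ.descHom hcov (α ≫ β) (fun γ => by rw [← Category.assoc, hα, Category.assoc, hβ, Category.assoc]) =
      ρ.descHom hcov α hα ≫ ρ.descHom hcov β hβ :=
  (ρ.descHom_unique hcov (α ≫ β) _ (by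
    rw [ρ.gluedMk_descHom_assoc, ρ.gluedMk_descHom, Category.assoc])).symm

/-! ## §3 The descended action of a commuting group -/

section DescAction

variable {G : Type*} [Group G] (σ : ActionOver r G)
  (hcomm : ∀ (γ : Γ) (g : G), (ρ.aut γ).hom ≫ (σ.aut g).hom = (σ.aut g).hom ≫ (ρ.aut γ).hom)

/-- The descended automorphism of `X/Γ` attached to `g ∈ G`. [cite: MumfordAV1970, §7 Thm. p. 66 (Remark)] -/
def descAut (g : G) : ρ.glued ≅ ρ.glued where
  hom := ρ.descHom hcov (σ.aut g).hom (fun γ => hcomm γ g)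
  inv := ρ.descHom hcov (σ.aut g⁻¹).hom (fun γ => hcomm γ g⁻¹)
  hom_inv_id := by
    rw [← ρ.descHom_comp hcov, ← ρ.descHom_id hcov]
    congr 1
    rw [← Iso.trans_hom, ← Aut.Aut_mul_def, ← map_mul, inv_mul_cancel, map_one]
    rfl
  inv_hom_id := by
    rw [← ρ.descHom_comp hcov, ← ρ.descHom_id hcov]
    congr 1
    rw [← Iso.trans_hom, ← Aut.Aut_mul_def, ← map_mul, mul_inv_cancel, map_one]
    rfl

/-- Unfolding `descAut`. [cite: MumfordAV1970, §7 Thm. p. 66 (Remark)] -/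
theorem descAut_hom (g : G) : (ρ.descAut hcov σ hcomm g).hom = ρ.descHom hcov (σ.aut g).hom (fun γ => hcomm γ g) := rfl

/-- `σ(g) ≫ π = π ≫ descAut g`. [cite: MumfordAV1970, §7 Thm. p. 66 (Remark)] -/
@[reassoc]
theorem gluedMk_descAut_hom (g : G) :
    ρ.gluedMk hcov ≫ (ρ.descAut hcov σ hcomm g).hom = (σ.aut g).hom ≫ ρ.gluedMk hcov := by
  rw [descAut_hom, ρ.gluedMk_descHom]

/-- `g ↦ descAut g` is a group homomorphism `G →* Aut (X/Γ)` (Mathlib's `Aut` multiplies by `f * g = g ≫ f`, as does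
`ActionOver.aut`). [cite: MumfordAV1970, §7 Thm. p. 66 (Remark)] -/
def descAutHom : G →* Aut ρ.glued where
  toFun := ρ.descAut hcov σ hcomm
  map_one' := by
    ext : 1
    rw [descAut_hom]
    refine (ρ.descHom_unique hcov (σ.aut 1).hom (fun γ => hcomm γ 1) ?_).symm
    rw [map_one]
    change ρ.gluedMk hcov ≫ 𝟙 _ = 𝟙 X ≫ ρ.gluedMk hcov
    rw [Category.comp_id, Category.id_comp]
  map_mul' g h := by
    ext : 1
    rw [descAut_hom, Aut.Aut_mul_def, Iso.trans_hom]
    refine (ρ.descHom_unique hcov (σ.aut (g * h)).hom (fun γ => hcomm γ (g * h)) ?_).symm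
    rw [ρ.gluedMk_descAut_hom_assoc, ρ.gluedMk_descAut_hom, map_mul, Aut.Aut_mul_def, Iso.trans_hom, Category.assoc]

/-- Unfolding `descAutHom`. [cite: MumfordAV1970, §7 Thm. p. 66 (Remark)] -/
theorem descAutHom_apply_hom (g : G) :
    (ρ.descAutHom hcov σ hcomm g).hom = ρ.descHom hcov (σ.aut g).hom (fun γ => hcomm γ g) := rfl

/-- **The descended action of `G` on `X/Γ` over `Y`** (for `σ` commuting with `ρ`): `g` acts by the unique `ḡ` with `π ≫ ḡ = g ≫ π`.
[cite: MumfordAV1970, §7 Thm. p. 66 (Remark)] [cite: SGA1, Exp. V, Prop. 1.1] -/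
def descAction : ActionOver (ρ.gluedDesc r ρ.aut_comp) G where
  aut := ρ.descAutHom hcov σ hcomm
  aut_comp g := by
    haveI := ρ.isSeparated_glued hcov
    rw [descAutHom_apply_hom]
    apply ρ.glued_hom_ext hcov
    rw [ρ.gluedMk_descHom_assoc, ρ.gluedMk_gluedDesc, σ.aut_comp]

/-- The descended action on `g` is the descent of `σ(g)` (unfolding). [cite: MumfordAV1970, §7 Thm. p. 66 (Remark)] -/
theorem descAction_aut_hom (g : G) :
    ((ρ.descAction hcov σ hcomm).aut g).hom = ρ.descHom hcov (σ.aut g).hom (fun γ => hcomm γ g) := rfl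

/-- **`π` intertwines `σ` and the descended action**: `σ(g) ≫ π = π ≫ ḡ`. [cite: MumfordAV1970, §7 Thm. p. 66 (Remark)] -/
@[reassoc]
theorem aut_hom_gluedMk_descAction (g : G) :
    (σ.aut g).hom ≫ ρ.gluedMk hcov = ρ.gluedMk hcov ≫ ((ρ.descAction hcov σ hcomm).aut g).hom := by
  rw [descAction_aut_hom, ρ.gluedMk_descHom]

/-- Uniqueness: an endomorphism `β` of `X/Γ` with `σ(g) ≫ π = π ≫ β` is `ḡ`. [cite: MumfordAV1970, §7 Thm. p. 66 (Remark)] -/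
theorem descAction_aut_unique (g : G) {β : ρ.glued ⟶ ρ.glued} (hβ : ρ.gluedMk hcov ≫ β = (σ.aut g).hom ≫ ρ.gluedMk hcov) :
    β = ((ρ.descAction hcov σ hcomm).aut g).hom := by
  rw [descAction_aut_hom]
  exact ρ.descHom_unique hcov _ _ hβ

/-- On points: `ḡ (π x) = π (σ(g) x)`. [cite: MumfordAV1970, §7 Thm. p. 66 (Remark)] -/
theorem descAction_aut_apply (g : G) (x : X) :
    ((ρ.descAction hcov σ hcomm).aut g).hom (ρ.gluedMk hcov x) = ρ.gluedMk hcov ((σ.aut g).hom x) := by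
  rw [← Scheme.Hom.comp_apply, ← ρ.aut_hom_gluedMk_descAction hcov σ hcomm g, Scheme.Hom.comp_apply]

/-! ## §4 The stable affine cover of `X/Γ` for the descended action (`Y` affine) -/

/-- The image chart `O/Γ ↪ X/Γ` of a `Γ`-stable, `σ`-stable open `O` affine over `Y` is stable under the descended action. [cite: MumfordAV1970, §7 Thm. p. 66 (Remark)] -/
theorem preimage_descAction_opensRange_gluedι (O : ρ.StableAffineOpens) (hO : ∀ g : G, (σ.aut g).hom ⁻¹ᵁ O.1 = O.1) (g : G) :
    ((ρ.descAction hcov σ hcomm).aut g).hom ⁻¹ᵁ (ρ.gluedι O).opensRange = (ρ.gluedι O).opensRange := by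
  -- both inclusions from `ḡ(π(O)) = π(σ(g) O) = π(O)`, for `g` and `g⁻¹`
  have key : ∀ (g : G) (z : ρ.glued), z ∈ (ρ.gluedι O).opensRange →
      ((ρ.descAction hcov σ hcomm).aut g).hom z ∈ (ρ.gluedι O).opensRange := by
    intro g z hz
    have hz' : z ∈ (ρ.gluedMk hcov ⁻¹ᵁ (ρ.gluedι O).opensRange).1.image (ρ.gluedMk hcov) := by
      obtain ⟨x, rfl⟩ := ρ.gluedMk_surjective hcov z
      exact ⟨x, hz, rfl⟩
    rw [ρ.preimage_opensRange_gluedι hcov O] at hz'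
    obtain ⟨x, hx, rfl⟩ := hz'
    rw [descAction_aut_apply]
    have hgx : (σ.aut g).hom x ∈ O.1 := by
      have : x ∈ (σ.aut g).hom ⁻¹ᵁ O.1 := by rw [hO g]; exact hx
      exact this
    rw [ρ.gluedMk_apply hcov O ⟨(σ.aut g).hom x, hgx⟩]
    exact ⟨_, rfl⟩
  ext z
  constructor
  · intro hz
    have h := key g⁻¹ _ hz
    rwa [← Scheme.Hom.comp_apply, ← Iso.trans_hom, ← Aut.Aut_mul_def, ← map_mul, inv_mul_cancel, map_one] at h
  · intro hz
    exact key g z hz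

/-- **Every point of `X/Γ` lies in an open which is stable under the descended action and affine over the AFFINE base `Y`**, provided
every point of `X` lies in a `Γ`-stable, `σ`-stable open affine over `Y` (its image chart `O/Γ ↪ X/Γ` does it: ★ `isAffine_pieceQuot`).
This is Mumford's hypothesis for the descended action («the quotient of an affine by a finite group is affine»).
[cite: SGA1, Exp. V, Prop. 1.8] [cite: MumfordAV1970, §7 Thm. p. 66 (Remark)] -/
theorem exists_stableAffineOpen_descAction [IsAffine Y]
    (hcov₂ : ∀ x : X, ∃ O : ρ.StableAffineOpens, (∀ g : G, (σ.aut g).hom ⁻¹ᵁ O.1 = O.1) ∧ x ∈ O.1) (z : ρ.glued) :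
    ∃ W : (ρ.descAction hcov σ hcomm).StableAffineOpens, z ∈ W.1 := by
  obtain ⟨x, rfl⟩ := ρ.gluedMk_surjective hcov z
  obtain ⟨O, hO, hx⟩ := hcov₂ x
  haveI : IsAffine (ρ.pieceQuot O) := ρ.isAffine_pieceQuot O
  have hWa : IsAffineOpen (ρ.gluedι O).opensRange := isAffineOpen_opensRange (ρ.gluedι O)
  haveI : IsAffine ((ρ.gluedι O).opensRange : Scheme.{u}) := hWa
  refine ⟨⟨(ρ.gluedι O).opensRange, ρ.preimage_descAction_opensRange_gluedι hcov σ hcomm O hO, inferInstance⟩, ?_⟩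
  change ρ.gluedMk hcov x ∈ (ρ.gluedι O).opensRange
  rw [ρ.gluedMk_apply hcov O ⟨x, hx⟩]
  exact ⟨_, rfl⟩

end DescAction

/-! ## §5 One action of `Γ × G` -/

section Prod

variable {G : Type*} [Group G]

omit [Finite Γ] [Y.IsSeparated] [IsSeparated r] in
/-- The `Γ`-part `θ ∘ inl` of an action of `Γ × G`. [folklore] -/
def fstAction {Γ G : Type*} [Group Γ] [Group G] (θ : ActionOver r (Γ × G)) : ActionOver r Γ :=
  ⟨θ.aut.comp (MonoidHom.inl Γ G), fun γ => θ.aut_comp (MonoidHom.inl Γ G γ)⟩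

omit [Finite Γ] [Y.IsSeparated] [IsSeparated r] in
/-- The `G`-part `θ ∘ inr` of an action of `Γ × G`. [folklore] -/
def sndAction {Γ G : Type*} [Group Γ] [Group G] (θ : ActionOver r (Γ × G)) : ActionOver r G :=
  ⟨θ.aut.comp (MonoidHom.inr Γ G), fun g => θ.aut_comp (MonoidHom.inr Γ G g)⟩

omit [Finite Γ] [Y.IsSeparated] [IsSeparated r] in
/-- Unfolding `fstAction`. [cite: MumfordAV1970, §7 Thm. p. 66 (Remark)] -/
@[simp] theorem fstAction_aut {Γ G : Type*} [Group Γ] [Group G] (θ : ActionOver r (Γ × G)) (γ : Γ) :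
    (fstAction θ).aut γ = θ.aut (γ, 1) := rfl

omit [Finite Γ] [Y.IsSeparated] [IsSeparated r] in
/-- Unfolding `sndAction`. [cite: MumfordAV1970, §7 Thm. p. 66 (Remark)] -/
@[simp] theorem sndAction_aut {Γ G : Type*} [Group Γ] [Group G] (θ : ActionOver r (Γ × G)) (g : G) :
    (sndAction θ).aut g = θ.aut (1, g) := rfl

omit [Finite Γ] [Y.IsSeparated] [IsSeparated r] in
/-- The two parts of an action of `Γ × G` commute. [cite: MumfordAV1970, §7 Thm. p. 66 (Remark)] -/
theorem fstAction_comm_sndAction {Γ G : Type*} [Group Γ] [Group G] (θ : ActionOver r (Γ × G)) (γ : Γ) (g : G) :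
    ((fstAction θ).aut γ).hom ≫ ((sndAction θ).aut g).hom = ((sndAction θ).aut g).hom ≫ ((fstAction θ).aut γ).hom := by
  rw [fstAction_aut, sndAction_aut, ← Iso.trans_hom, ← Iso.trans_hom, ← Aut.Aut_mul_def, ← Aut.Aut_mul_def, ← map_mul,
    ← map_mul, Prod.mk_mul_mk, Prod.mk_mul_mk, mul_one, one_mul, one_mul, mul_one]

omit [Finite Γ] [Y.IsSeparated] [IsSeparated r] in
/-- A `θ`-stable open is stable under both parts. [cite: MumfordAV1970, §7 Thm. p. 66 (Remark)] -/
theorem preimage_sndAction_of_stable {Γ G : Type*} [Group Γ] [Group G] (θ : ActionOver r (Γ × G)) (O : θ.StableAffineOpens)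
    (g : G) : ((sndAction θ).aut g).hom ⁻¹ᵁ O.1 = O.1 := O.2.1 (1, g)

omit [Finite Γ] [Y.IsSeparated] [IsSeparated r] in
/-- A `θ`-stable open affine over `Y` as a stable affine open for the `Γ`-part. [folklore] -/
def StableAffineOpens.fst {Γ G : Type*} [Group Γ] [Group G] (θ : ActionOver r (Γ × G)) (O : θ.StableAffineOpens) :
    (fstAction θ).StableAffineOpens :=
  ⟨O.1, fun γ => O.2.1 (γ, 1), O.2.2⟩

omit [Finite Γ] [Y.IsSeparated] [IsSeparated r] in
/-- Mumford's hypothesis passes from `θ` to its `Γ`-part. [cite: MumfordAV1970, §7 Thm. p. 66 (Remark)] -/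
theorem hcov_fstAction {Γ G : Type*} [Group Γ] [Group G] (θ : ActionOver r (Γ × G))
    (hcovθ : ∀ x : X, ∃ O : θ.StableAffineOpens, x ∈ O.1) :
    ∀ x : X, ∃ O : (fstAction θ).StableAffineOpens, x ∈ O.1 := fun x => by
  obtain ⟨O, hx⟩ := hcovθ x
  exact ⟨StableAffineOpens.fst θ O, hx⟩

omit [Finite Γ] [Y.IsSeparated] [IsSeparated r] in
/-- And supplies the `Γ`-stable, `G`-stable affine cover needed for the descended action. [cite: MumfordAV1970, §7 Thm. p. 66 (Remark)] -/
theorem hcov₂_of_prod {Γ G : Type*} [Group Γ] [Group G] (θ : ActionOver r (Γ × G))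
    (hcovθ : ∀ x : X, ∃ O : θ.StableAffineOpens, x ∈ O.1) :
    ∀ x : X, ∃ O : (fstAction θ).StableAffineOpens, (∀ g : G, ((sndAction θ).aut g).hom ⁻¹ᵁ O.1 = O.1) ∧ x ∈ O.1 :=
  fun x => by
    obtain ⟨O, hx⟩ := hcovθ x
    exact ⟨StableAffineOpens.fst θ O, fun g => O.2.1 (1, g), hx⟩

end Prod

end Literature.AlgebraicGeometry.RelativeSpec.ActionOver
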